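import Summits.Ventures.PercRepro.Night2ThreeFatCount

/-!
# PercRepro — the binomial arithmetic of the FOUR-disjoint-hyperplane count (night-2, gen 23)

* `cntDisjFour ρ s = C(s, ρ) − 4·C(s − 2, ρ) + 6·C(s − 4, ρ)` — the count function of four fat hyperplanes with
  pairwise disjoint missed sets (`cntDisjFour_six_pos`: positive for `7 ≤ s ≤ 12`);
* `choose_diff_one … choose_diff_four` — the first four finite differences of `C(·, k)` are nonnegative (Pascal);
* **`choose_four_disjoint_le`** (81 cases, `p_i = 2 − a_i`, `s = m + 8`, top index `t + 4`): the sixteen-term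
  inclusion–exclusion count `Σ_{J ⊆ [4]} (−1)^|J| C(s − Σ_J a_i)` of the `ρ`-subsets of an `s`-set meeting four
  disjoint sets of sizes `a_i ≤ 2` is at most `C(s) − 4C(s−2) + 6C(s−4)` — spelled with the positive terms on the
  left, proved case by case from the nonnegativity of the differences on `m, …, m + 8` (`omega`).

The count itself is `card_coverBases_le_cntDisjFour` in `Night2FourFatCount`.
-/

namespace PercRepro.Shadow

open Finset PerFlat ThmH

/-- The count function of four fat hyperplanes with pairwise disjoint missed sets of size `≤ 2`:
`C(s, ρ) − 4·C(s − 2, ρ) + 6·C(s − 4, ρ)`. -/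
noncomputable def cntDisjFour (ρ s : ℕ) : ℚ :=
  (s.choose ρ : ℚ) - 4 * ((s - 2).choose ρ : ℚ) + 6 * ((s - 4).choose ρ : ℚ)

/-- `cntDisjFour 6 s > 0` for `7 ≤ s ≤ 12`. -/
theorem cntDisjFour_six_pos : ∀ s, 7 ≤ s → s ≤ 12 → 0 < cntDisjFour 6 s := by
  intro s h1 h2
  unfold cntDisjFour
  interval_cases s <;> norm_num [Nat.choose_eq_descFactorial_div_factorial, Nat.descFactorial, Nat.factorial]

/-- The first difference of `C(·, k)` is nonnegative: `C(N, k) ≤ C(N + 1, k)`. -/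
theorem choose_diff_one (N k : ℕ) : N.choose k ≤ (N + 1).choose k := Nat.choose_le_choose k (by omega)

/-- The second difference of `C(·, k + 2)` is nonnegative: `2·C(N+1, k+2) ≤ C(N+2, k+2) + C(N, k+2)`. -/
theorem choose_diff_two (N k : ℕ) : 2 * (N + 1).choose (k + 2) ≤ (N + 2).choose (k + 2) + N.choose (k + 2) := by
  have a1 : (N + 2).choose (k + 2) = (N + 1).choose (k + 1) + (N + 1).choose (k + 2) :=
    Nat.choose_succ_succ (N + 1) (k + 1)
  have a0 : (N + 1).choose (k + 2) = N.choose (k + 1) + N.choose (k + 2) := Nat.choose_succ_succ N (k + 1)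
  have b0 : N.choose (k + 1) ≤ (N + 1).choose (k + 1) := Nat.choose_le_choose (k + 1) (by omega)
  omega

/-- The third difference of `C(·, k + 3)` is nonnegative:
`3·C(N+2, k+3) + C(N, k+3) ≤ C(N+3, k+3) + 3·C(N+1, k+3)`. -/
theorem choose_diff_three (N k : ℕ) :
    3 * (N + 2).choose (k + 3) + N.choose (k + 3) ≤ (N + 3).choose (k + 3) + 3 * (N + 1).choose (k + 3) := by
  have a2 : (N + 3).choose (k + 3) = (N + 2).choose (k + 2) + (N + 2).choose (k + 3) :=
    Nat.choose_succ_succ (N + 2) (k + 2)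
  have a1 : (N + 2).choose (k + 3) = (N + 1).choose (k + 2) + (N + 1).choose (k + 3) :=
    Nat.choose_succ_succ (N + 1) (k + 2)
  have a0 : (N + 1).choose (k + 3) = N.choose (k + 2) + N.choose (k + 3) := Nat.choose_succ_succ N (k + 2)
  have b := choose_diff_two N k
  omega

/-- The fourth difference of `C(·, k + 4)` is nonnegative:
`4·C(N+3, k+4) + 4·C(N+1, k+4) ≤ C(N+4, k+4) + 6·C(N+2, k+4) + C(N, k+4)`. -/
theorem choose_diff_four (N k : ℕ) :
    4 * (N + 3).choose (k + 4) + 4 * (N + 1).choose (k + 4) ≤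
      (N + 4).choose (k + 4) + 6 * (N + 2).choose (k + 4) + N.choose (k + 4) := by
  have a3 : (N + 4).choose (k + 4) = (N + 3).choose (k + 3) + (N + 3).choose (k + 4) :=
    Nat.choose_succ_succ (N + 3) (k + 3)
  have a2 : (N + 3).choose (k + 4) = (N + 2).choose (k + 3) + (N + 2).choose (k + 4) :=
    Nat.choose_succ_succ (N + 2) (k + 3)
  have a1 : (N + 2).choose (k + 4) = (N + 1).choose (k + 3) + (N + 1).choose (k + 4) :=
    Nat.choose_succ_succ (N + 1) (k + 3)
  have a0 : (N + 1).choose (k + 4) = N.choose (k + 3) + N.choose (k + 4) := Nat.choose_succ_succ N (k + 3)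
  have b := choose_diff_three N k
  omega

/-- `choose_four_disjoint_le` at `p₃ = 0` (27 cases). -/
theorem choose_four_disjoint_le_aux0 (t m p₀ p₁ p₂ : ℕ) (h₀ : p₀ ≤ 2) (h₁ : p₁ ≤ 2) (h₂ : p₂ ≤ 2) :
    4 * (m + 6).choose (t + 4) + (m + 4 + p₀ + p₁).choose (t + 4) + (m + 4 + p₀ + p₂).choose (t + 4) +
        (m + 4 + p₁ + p₂).choose (t + 4) + (m + 4 + p₀ + 0).choose (t + 4) + (m + 4 + p₁ + 0).choose (t + 4) +
        (m + 4 + p₂ + 0).choose (t + 4) + (m + p₀ + p₁ + p₂ + 0).choose (t + 4) ≤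
      (m + 6 + p₀).choose (t + 4) + (m + 6 + p₁).choose (t + 4) + (m + 6 + p₂).choose (t + 4) +
        (m + 6 + 0).choose (t + 4) + (m + 2 + p₀ + p₁ + p₂).choose (t + 4) +
        (m + 2 + p₀ + p₁ + 0).choose (t + 4) + (m + 2 + p₀ + p₂ + 0).choose (t + 4) +
        (m + 2 + p₁ + p₂ + 0).choose (t + 4) + 6 * (m + 4).choose (t + 4) := by
  have d10 := choose_diff_one m (t + 4)
  have d11 := choose_diff_one (m + 1) (t + 4)
  have d12 := choose_diff_one (m + 2) (t + 4)
  have d13 := choose_diff_one (m + 3) (t + 4)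
  have d14 := choose_diff_one (m + 4) (t + 4)
  have d15 := choose_diff_one (m + 5) (t + 4)
  have d16 := choose_diff_one (m + 6) (t + 4)
  have d17 := choose_diff_one (m + 7) (t + 4)
  have d20 := choose_diff_two m (t + 2)
  have d21 := choose_diff_two (m + 1) (t + 2)
  have d22 := choose_diff_two (m + 2) (t + 2)
  have d23 := choose_diff_two (m + 3) (t + 2)
  have d24 := choose_diff_two (m + 4) (t + 2)
  have d25 := choose_diff_two (m + 5) (t + 2)
  have d26 := choose_diff_two (m + 6) (t + 2)
  have d30 := choose_diff_three m (t + 1)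
  have d31 := choose_diff_three (m + 1) (t + 1)
  have d32 := choose_diff_three (m + 2) (t + 1)
  have d33 := choose_diff_three (m + 3) (t + 1)
  have d34 := choose_diff_three (m + 4) (t + 1)
  have d35 := choose_diff_three (m + 5) (t + 1)
  have d40 := choose_diff_four m t
  have d41 := choose_diff_four (m + 1) t
  have d42 := choose_diff_four (m + 2) t
  have d43 := choose_diff_four (m + 3) t
  have d44 := choose_diff_four (m + 4) t
  interval_cases p₀ <;> interval_cases p₁ <;> interval_cases p₂ <;>
    simp only [Nat.add_zero, Nat.add_assoc, Nat.reduceAdd] at * <;> omega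

/-- `choose_four_disjoint_le` at `p₃ = 1` (27 cases). -/
theorem choose_four_disjoint_le_aux1 (t m p₀ p₁ p₂ : ℕ) (h₀ : p₀ ≤ 2) (h₁ : p₁ ≤ 2) (h₂ : p₂ ≤ 2) :
    4 * (m + 6).choose (t + 4) + (m + 4 + p₀ + p₁).choose (t + 4) + (m + 4 + p₀ + p₂).choose (t + 4) +
        (m + 4 + p₁ + p₂).choose (t + 4) + (m + 4 + p₀ + 1).choose (t + 4) + (m + 4 + p₁ + 1).choose (t + 4) +
        (m + 4 + p₂ + 1).choose (t + 4) + (m + p₀ + p₁ + p₂ + 1).choose (t + 4) ≤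
      (m + 6 + p₀).choose (t + 4) + (m + 6 + p₁).choose (t + 4) + (m + 6 + p₂).choose (t + 4) +
        (m + 6 + 1).choose (t + 4) + (m + 2 + p₀ + p₁ + p₂).choose (t + 4) +
        (m + 2 + p₀ + p₁ + 1).choose (t + 4) + (m + 2 + p₀ + p₂ + 1).choose (t + 4) +
        (m + 2 + p₁ + p₂ + 1).choose (t + 4) + 6 * (m + 4).choose (t + 4) := by
  have d10 := choose_diff_one m (t + 4)
  have d11 := choose_diff_one (m + 1) (t + 4)
  have d12 := choose_diff_one (m + 2) (t + 4)
  have d13 := choose_diff_one (m + 3) (t + 4)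
  have d14 := choose_diff_one (m + 4) (t + 4)
  have d15 := choose_diff_one (m + 5) (t + 4)
  have d16 := choose_diff_one (m + 6) (t + 4)
  have d17 := choose_diff_one (m + 7) (t + 4)
  have d20 := choose_diff_two m (t + 2)
  have d21 := choose_diff_two (m + 1) (t + 2)
  have d22 := choose_diff_two (m + 2) (t + 2)
  have d23 := choose_diff_two (m + 3) (t + 2)
  have d24 := choose_diff_two (m + 4) (t + 2)
  have d25 := choose_diff_two (m + 5) (t + 2)
  have d26 := choose_diff_two (m + 6) (t + 2)
  have d30 := choose_diff_three m (t + 1)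
  have d31 := choose_diff_three (m + 1) (t + 1)
  have d32 := choose_diff_three (m + 2) (t + 1)
  have d33 := choose_diff_three (m + 3) (t + 1)
  have d34 := choose_diff_three (m + 4) (t + 1)
  have d35 := choose_diff_three (m + 5) (t + 1)
  have d40 := choose_diff_four m t
  have d41 := choose_diff_four (m + 1) t
  have d42 := choose_diff_four (m + 2) t
  have d43 := choose_diff_four (m + 3) t
  have d44 := choose_diff_four (m + 4) t
  interval_cases p₀ <;> interval_cases p₁ <;> interval_cases p₂ <;>
    simp only [Nat.add_zero, Nat.add_assoc, Nat.reduceAdd] at * <;> omega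

/-- `choose_four_disjoint_le` at `p₃ = 2` (27 cases). -/
theorem choose_four_disjoint_le_aux2 (t m p₀ p₁ p₂ : ℕ) (h₀ : p₀ ≤ 2) (h₁ : p₁ ≤ 2) (h₂ : p₂ ≤ 2) :
    4 * (m + 6).choose (t + 4) + (m + 4 + p₀ + p₁).choose (t + 4) + (m + 4 + p₀ + p₂).choose (t + 4) +
        (m + 4 + p₁ + p₂).choose (t + 4) + (m + 4 + p₀ + 2).choose (t + 4) + (m + 4 + p₁ + 2).choose (t + 4) +
        (m + 4 + p₂ + 2).choose (t + 4) + (m + p₀ + p₁ + p₂ + 2).choose (t + 4) ≤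
      (m + 6 + p₀).choose (t + 4) + (m + 6 + p₁).choose (t + 4) + (m + 6 + p₂).choose (t + 4) +
        (m + 6 + 2).choose (t + 4) + (m + 2 + p₀ + p₁ + p₂).choose (t + 4) +
        (m + 2 + p₀ + p₁ + 2).choose (t + 4) + (m + 2 + p₀ + p₂ + 2).choose (t + 4) +
        (m + 2 + p₁ + p₂ + 2).choose (t + 4) + 6 * (m + 4).choose (t + 4) := by
  have d10 := choose_diff_one m (t + 4)
  have d11 := choose_diff_one (m + 1) (t + 4)
  have d12 := choose_diff_one (m + 2) (t + 4)
  have d13 := choose_diff_one (m + 3) (t + 4)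
  have d14 := choose_diff_one (m + 4) (t + 4)
  have d15 := choose_diff_one (m + 5) (t + 4)
  have d16 := choose_diff_one (m + 6) (t + 4)
  have d17 := choose_diff_one (m + 7) (t + 4)
  have d20 := choose_diff_two m (t + 2)
  have d21 := choose_diff_two (m + 1) (t + 2)
  have d22 := choose_diff_two (m + 2) (t + 2)
  have d23 := choose_diff_two (m + 3) (t + 2)
  have d24 := choose_diff_two (m + 4) (t + 2)
  have d25 := choose_diff_two (m + 5) (t + 2)
  have d26 := choose_diff_two (m + 6) (t + 2)
  have d30 := choose_diff_three m (t + 1)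
  have d31 := choose_diff_three (m + 1) (t + 1)
  have d32 := choose_diff_three (m + 2) (t + 1)
  have d33 := choose_diff_three (m + 3) (t + 1)
  have d34 := choose_diff_three (m + 4) (t + 1)
  have d35 := choose_diff_three (m + 5) (t + 1)
  have d40 := choose_diff_four m t
  have d41 := choose_diff_four (m + 1) t
  have d42 := choose_diff_four (m + 2) t
  have d43 := choose_diff_four (m + 3) t
  have d44 := choose_diff_four (m + 4) t
  interval_cases p₀ <;> interval_cases p₁ <;> interval_cases p₂ <;>
    simp only [Nat.add_zero, Nat.add_assoc, Nat.reduceAdd] at * <;> omega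

/-- **Binomial inequality behind the four-disjoint-hyperplane count.** With `p_i = 2 − a_i` and `s = m + 8`, the
sixteen-term count `Σ_{J ⊆ [4]} (−1)^|J| C(s − Σ_J a_i)` of the `ρ`-subsets meeting four disjoint sets of sizes `a_i`
is at most `C(s) − 4C(s−2) + 6C(s−4)`, spelled with the positive terms on the left (top index `t + 4`); from the
nonnegativity of the first four differences of `C(·, t + 4)` on `m, …, m + 8` (81 cases). -/
theorem choose_four_disjoint_le (t m p₀ p₁ p₂ p₃ : ℕ) (h₀ : p₀ ≤ 2) (h₁ : p₁ ≤ 2) (h₂ : p₂ ≤ 2) (h₃ : p₃ ≤ 2) :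
    4 * (m + 6).choose (t + 4) + (m + 4 + p₀ + p₁).choose (t + 4) + (m + 4 + p₀ + p₂).choose (t + 4) +
        (m + 4 + p₁ + p₂).choose (t + 4) + (m + 4 + p₀ + p₃).choose (t + 4) + (m + 4 + p₁ + p₃).choose (t + 4) +
        (m + 4 + p₂ + p₃).choose (t + 4) + (m + p₀ + p₁ + p₂ + p₃).choose (t + 4) ≤
      (m + 6 + p₀).choose (t + 4) + (m + 6 + p₁).choose (t + 4) + (m + 6 + p₂).choose (t + 4) +
        (m + 6 + p₃).choose (t + 4) + (m + 2 + p₀ + p₁ + p₂).choose (t + 4) +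
        (m + 2 + p₀ + p₁ + p₃).choose (t + 4) + (m + 2 + p₀ + p₂ + p₃).choose (t + 4) +
        (m + 2 + p₁ + p₂ + p₃).choose (t + 4) + 6 * (m + 4).choose (t + 4) := by
  interval_cases p₃
  · exact choose_four_disjoint_le_aux0 t m p₀ p₁ p₂ h₀ h₁ h₂
  · exact choose_four_disjoint_le_aux1 t m p₀ p₁ p₂ h₀ h₁ h₂
  · exact choose_four_disjoint_le_aux2 t m p₀ p₁ p₂ h₀ h₁ h₂

end PercRepro.Shadow
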